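import Mathlib.Analysis.Complex.Polynomial.Basic
import Mathlib.FieldTheory.IsAlgClosed.Basic
import Mathlib.Tactic
import HarnessLib

/-!
# The quotient charts of the `A₁` and `A₃` surface germs

Kernel leaf for the W1 twisted squad (cell `pub-hsemireg`, seat w1-tw-2 gen 12): the algebraic skeleton of the two
local models used in CC note §26.7 (P2) (EXPLICIT INSTANCES) and in REPAIR R-tw2-P3-1 of `PSTU-READ-tw2.md`:

* `A₁`:  `Φ₁(s,t) = (s², -t², s t)` lands in `{w² + μ u = 0}`, is invariant under `(s,t) ↦ (-s,-t)`, and is onto the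
  zero set over `ℂ`;
* `A₃`:  `Φ₃(s,t) = (s t, s⁴, -t⁴)` lands in `{x⁴ + y z = 0}`, is invariant under `(s,t) ↦ (I s, -I t)`, and is onto the
  zero set over `ℂ`.

The invariance is what makes the quarter-turn path `θ ↦ (e^{iθ/4}s, e^{-iθ/4}t)` a CLOSED loop on the germ (it joins
`(s,t)` to `(I s, -I t)`), winding `y` by `+1` and `z` by `-1`; surjectivity says the chart misses no point of the germ.
Honest framing: elementary algebra over `ℂ` (theorems only); nothing here bears on HC / HC_CM / HC_AV.
-/

namespace Summit.Ventures.HSemireg.QuotientChartsA1A3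

open Complex

/-- The `A₁` chart lands in the germ `w² + μu = 0` (with `(μ, u, w) = (s², -t², st)`). -/
theorem a1_chart_mem {R : Type*} [CommRing R] (s t : R) :
    (s * t) ^ 2 + (s ^ 2) * (-t ^ 2) = 0 := by
  ring

/-- The `A₁` chart is invariant under the antipodal map `(s,t) ↦ (-s,-t)`. -/
theorem a1_chart_neg {R : Type*} [CommRing R] (s t : R) :
    ((-s) ^ 2, -(-t) ^ 2, (-s) * (-t)) = (s ^ 2, -t ^ 2, s * t) := by
  ext <;> ring

/-- The `A₃` chart lands in the germ `x⁴ + yz = 0` (with `(x, y, z) = (st, s⁴, -t⁴)`). -/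
theorem a3_chart_mem {R : Type*} [CommRing R] (s t : R) :
    (s * t) ^ 4 + (s ^ 4) * (-t ^ 4) = 0 := by
  ring

/-- The `A₃` chart is invariant under the order-four map `(s,t) ↦ (I s, -I t)` of `ℂ²`. -/
theorem a3_chart_quarter_turn (s t : ℂ) :
    ((I * s) * (-I * t), (I * s) ^ 4, -(-I * t) ^ 4) = (s * t, s ^ 4, -t ^ 4) := by
  have h4 : I ^ 4 = 1 := by
    rw [show (4 : ℕ) = 2 * 2 from rfl, pow_mul, I_sq]; norm_num
  refine Prod.ext ?_ (Prod.ext ?_ ?_)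
  · show I * s * (-I * t) = s * t
    have : I * s * (-I * t) = -(I * I) * (s * t) := by ring
    rw [this, I_mul_I]; ring
  · show (I * s) ^ 4 = s ^ 4
    rw [mul_pow, h4, one_mul]
  · show -(-I * t) ^ 4 = -t ^ 4
    rw [mul_pow, show (-I) ^ 4 = I ^ 4 by ring, h4, one_mul]

/-- Every point of the `A₁` germ `w² + μu = 0` over `ℂ` is in the image of the chart `(s,t) ↦ (s², -t², st)`. -/
theorem a1_chart_surjective (μ u w : ℂ) (h : w ^ 2 + μ * u = 0) :
    ∃ s t : ℂ, s ^ 2 = μ ∧ -t ^ 2 = u ∧ s * t = w := by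
  obtain ⟨s, hs⟩ := IsAlgClosed.exists_pow_nat_eq μ (by norm_num : 0 < 2)
  by_cases hs0 : s = 0
  · subst hs0
    have hμ : μ = 0 := by simpa using hs.symm
    have hw : w = 0 := by
      have : w ^ 2 = 0 := by rw [hμ] at h; simpa using h
      exact pow_eq_zero_iff (two_ne_zero) |>.mp this
    obtain ⟨t, ht⟩ := IsAlgClosed.exists_pow_nat_eq (-u) (by norm_num : 0 < 2)
    exact ⟨0, t, by simpa using hμ.symm, by rw [ht]; ring, by simp [hw]⟩
  · refine ⟨s, w / s, hs, ?_, by field_simp⟩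
    have hw2 : w ^ 2 = -(s ^ 2 * u) := by rw [hs]; linear_combination h
    rw [div_pow, hw2]
    field_simp

/-- Every point of the `A₃` germ `x⁴ + yz = 0` over `ℂ` is in the image of the chart `(s,t) ↦ (st, s⁴, -t⁴)`. -/
theorem a3_chart_surjective (x y z : ℂ) (h : x ^ 4 + y * z = 0) :
    ∃ s t : ℂ, s * t = x ∧ s ^ 4 = y ∧ -t ^ 4 = z := by
  obtain ⟨s, hs⟩ := IsAlgClosed.exists_pow_nat_eq y (by norm_num : 0 < 4)
  by_cases hs0 : s = 0
  · subst hs0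
    have hy : y = 0 := by simpa using hs.symm
    have hx : x = 0 := by
      have : x ^ 4 = 0 := by rw [hy] at h; simpa using h
      exact pow_eq_zero_iff (by norm_num : (4 : ℕ) ≠ 0) |>.mp this
    obtain ⟨t, ht⟩ := IsAlgClosed.exists_pow_nat_eq (-z) (by norm_num : 0 < 4)
    exact ⟨0, t, by simp [hx], by simpa using hy.symm, by rw [ht]; ring⟩
  · refine ⟨s, x / s, by field_simp, hs, ?_⟩
    have hx4 : x ^ 4 = -(s ^ 4 * z) := by rw [hs]; linear_combination h
    rw [div_pow, hx4]
    field_simp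

end Summit.Ventures.HSemireg.QuotientChartsA1A3
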